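import Literature.Geometry.Riemannian.HeatKernelGaussianIntegralBound
import Literature.Geometry.Riemannian.RicciFlowHeatKernelFn
import Mathlib.MeasureTheory.Integral.Layercake
import Mathlib.Analysis.SpecialFunctions.ImproperIntegrals
import HarnessLib

/-!
# Tail exponential moments of the distance from an `H_m`-centre and the splitting (7.20)
# (Bamler 2020a, §7.3, proof of the Gaussian lemma for Thm. 7.2)

R. Bamler, *Entropy and heat kernel bounds on a Ricci flow background*, arXiv:2008.07093 (2020a),
§7.3, proof of Lemma 7.10 (arXiv v1: Lemma 28), display (7.20): for `a_i = K(x,1;y_i,0)`,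
`ν = ν_{x,1;θ}`, `V_i = {K(·,θ;y_i,0) ≥ a_i/2}`, an `H_n`-centre `(z', θ)` of `(x, 1)` and
`B' = B(z', θ, 10d)`,

  `a_i = ∫ K(·,θ;y_i,0) dν_θ`
  `    ≤ a_i/2 + (sup bound) · (ν_θ(V_i ∩ B') + ∫_{10d}^∞ e^{Cθ^{-1/2} r} ν_θ(M ∖ B(z',θ,r)) dr)`,

where the last (layer-cake) integral is controlled by the Gaussian concentration of `ν_θ` at its
`H_n`-centre (Thm. 3.12) and the elementary bound
`C θ^{-1/2} r − (r − √(2H_n))²/8 ≤ C θ^{-1} + r²/100 − r²/9 + C ≤ C θ^{-1} − r²/10 + C`.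

This file proves the two ingredients in clean, scale-covariant form, for a Ricci flow
`hflow = (h, cov)` on `[a, T]` of a `C^∞` family of Riemannian metrics on a closed connected
manifold `M` modelled on `ℝᵐ`, the tree's heat kernel function
`K(x,t;y,s) = hflow.heatKernelFn hh hR t x (y, s)` (`RicciFlowHeatKernelFn.lean`), heat kernel
measures `ν_{x,t;s} = heatKernelMeasure hh hR t x s` (`HeatKernelMeasures.lean`) and Riemannian
distance `d_s = (h s).edist (hR s)`; `H_m = (m − 1)π²/2 + 4`, `σ = t − s`:

* `setIntegral_exp_mul_edist_heatKernelMeasure_le` — **tail exponential moment at an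
  `H_m`-centre**: if `∫ d_s(z,·)² dν_{x,t;s} ≤ H_m σ`, then for `κ ≥ 0`, `R₀ > 0`

    `∫_{d_s(z,·) ≥ R₀} e^{κ d_s(z,·)} dν_{x,t;s} ≤ 2 e^{25κ²σ + 2H_m} (1 + 10κσ/R₀) e^{−R₀²/(10σ)}`;

  proof: Thm. 3.12 in kernel form (`heatKernelMeasure_real_setOf_le_edist_le`,
  `ν{d ≥ r} ≤ 2 exp(−(r − √(2H_mσ))₊²/(8σ))`), the two elementary inequalities
  `κ r ≤ r²/(100σ) + 25κ²σ`, `(r − A)₊² ≥ (8/9)r² − 8A²`, hence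
  `e^{κr} ν{d ≥ r} ≤ 2 e^{25κ²σ + 2H_m} e^{−r²/(10σ)}`, and the layer-cake formula
  (`MeasureTheory.lintegral_comp_eq_lintegral_meas_le_mul`) for `e^{κd} − 1 = ∫₀^d κe^{κr} dr`
  on `ν|_{d ≥ R₀}`, with `∫_{R₀}^∞ e^{−rR₀/(10σ)} dr = (10σ/R₀) e^{−R₀²/(10σ)}`
  (`setIntegral_exp_mul_le_of_forall_exp_mul_measureReal_le`, abstract probabilistic form);
* `heatKernelFn_le_of_forall_le_exp_mul_edist` — **the splitting (7.20)**: for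
  `a < s < t₁ < t ≤ T`, an `H_m`-centre `z'` of `(x, t)` at time `t₁` and a pointwise majorant
  `K(·,t₁;y,s) ≤ A₀ e^{κ d_{t₁}(z',·)}`,

    `K(x,t;y,s) ≤ 2A₀ (e^{κR₀} ν_{x,t;t₁}(V ∩ B) + tail)`,

  `V = {K(x,t;y,s) ≤ 2K(·,t₁;y,s)}`, `B = {d_{t₁}(z',·) < R₀}`, `tail` the bound of the first item
  at times `t₁ < t`; proof: reproduction `K(x,t;y,s) = ∫ K(·,t₁;y,s) dν_{x,t;t₁}`
  (`IsRicciFlow.heatKernelFn_reproduction`), `∫_{Vᶜ} ≤ a/2`, and on `V` the majorant split over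
  `B` and `Bᶜ = {d ≥ R₀}`.

Everything is proved; no definitions, no named facts. What is NOT here: the Gaussian lemma /
Thm. 7.2 themselves, the choice of the parameters `θ`, `Z`, the existence of `H_m`-centres,
non-compact `M`.

## References

* R. H. Bamler, *Entropy and heat kernel bounds on a Ricci flow background*, arXiv:2008.07093
  (2020), §3.1 Thm. 3.12, §7.3, proof of Lemma 7.10, display (7.20). [Bamler2020Entropy]
-/

noncomputable section

open Set Filter Function MeasureTheory Measure
open scoped Manifold ContDiff Topology ENNReal NNReal

namespace Literature.Geometry.Riemannian

open Lorentzian Lorentzian.PseudoRiemannianMetric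

/-! ### Two elementary inequalities -/

section Elementary

/-- `κ r ≤ r²/(100σ) + 25κ²σ` for `σ > 0`: the square `(r − 50κσ)² ≥ 0` divided by `100σ`.
[folklore] -/
theorem mul_le_sq_div_add_sq_mul {σ : ℝ} (hσ : 0 < σ) (κ r : ℝ) :
    κ * r ≤ r ^ 2 / (100 * σ) + 25 * κ ^ 2 * σ := by
  have hσ' : (0 : ℝ) < 100 * σ := by positivity
  rw [div_add' _ _ _ hσ'.ne', le_div_iff₀ hσ']
  nlinarith [sq_nonneg (r - 50 * κ * σ)]

/-- `(8/9) r² − 8A² ≤ (r − A)₊²` for `r ≥ 0`: if `A ≤ r` this is `(r/3 − 3A)² ≥ 0`, otherwise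
`(8/9) r² ≤ 8A²`. [folklore] -/
theorem sq_sub_sq_le_max_sub_sq {r : ℝ} (hr : 0 ≤ r) (A : ℝ) :
    8 / 9 * r ^ 2 - 8 * A ^ 2 ≤ (max (r - A) 0) ^ 2 := by
  rcases le_or_gt A r with hAr | hrA
  · rw [max_eq_left (sub_nonneg.2 hAr)]
    nlinarith [sq_nonneg (r / 3 - 3 * A)]
  · rw [max_eq_right (sub_neg.2 hrA).le]
    nlinarith [mul_self_le_mul_self hr hrA.le]

/-- `∫₀^T κ e^{κr} dr = e^{κT} − 1` (fundamental theorem of calculus). [folklore] -/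
theorem intervalIntegral_exp_mul_mul (κ T : ℝ) :
    ∫ r in (0 : ℝ)..T, Real.exp (κ * r) * κ = Real.exp (κ * T) - 1 := by
  have hd : ∀ r ∈ uIcc 0 T, HasDerivAt (fun r ↦ Real.exp (κ * r)) (Real.exp (κ * r) * κ) r := by
    intro r _
    have h1 : HasDerivAt (fun r ↦ κ * r) κ r := by simpa using (hasDerivAt_id r).const_mul κ
    exact h1.exp
  rw [intervalIntegral.integral_eq_sub_of_hasDerivAt hd
    ((by fun_prop : Continuous fun r ↦ Real.exp (κ * r) * κ).intervalIntegrable _ _),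
    mul_zero, Real.exp_zero]

end Elementary

/-! ### Layer cake: a truncated exponential moment from exponential tails -/

section LayerCake

/-- **Truncated exponential moments from tail bounds** (the layer-cake step in Bamler 2020a,
(7.20)). Let `ν` be a finite measure, `ψ ≥ 0` measurable, `κ ≥ 0`, `R₀, c > 0`, and suppose
`e^{κr} ν{ψ ≥ r} ≤ C e^{−cr}` for all `r ≥ R₀`. Then

  `∫_{ψ ≥ R₀} e^{κψ} dν ≤ C e^{−cR₀} (1 + κ/c)`.

Proof: `e^{κψ} = 1 + ∫₀^ψ κ e^{κr} dr`, so by the layer-cake formula on `ν|_{ψ ≥ R₀}`,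
`∫_{ψ ≥ R₀} e^{κψ} = ν{ψ ≥ R₀} + ∫₀^∞ κe^{κr} ν{ψ ≥ max(r, R₀)} dr
 = e^{κR₀} ν{ψ ≥ R₀} + ∫_{R₀}^∞ κ e^{κr} ν{ψ ≥ r} dr ≤ C e^{−cR₀} + κ C ∫_{R₀}^∞ e^{−cr} dr`.
[folklore] -/
theorem setIntegral_exp_mul_le_of_forall_exp_mul_measureReal_le {X : Type*} [MeasurableSpace X]
    (ν : Measure X) [IsFiniteMeasure ν] {ψ : X → ℝ} (hψm : Measurable ψ) (hψ0 : ∀ y, 0 ≤ ψ y)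
    {κ R₀ c C : ℝ} (hκ : 0 ≤ κ) (hR₀ : 0 < R₀) (hc : 0 < c)
    (htail : ∀ r, R₀ ≤ r → Real.exp (κ * r) * ν.real {y | r ≤ ψ y} ≤ C * Real.exp (-c * r)) :
    ∫ y in {y | R₀ ≤ ψ y}, Real.exp (κ * ψ y) ∂ν ≤ C * Real.exp (-c * R₀) * (1 + κ / c) := by
  set S : Set X := {y | R₀ ≤ ψ y} with hS
  set μ : Measure X := ν.restrict S with hμ
  have hlev : ∀ r : ℝ, MeasurableSet {y | r ≤ ψ y} := fun r ↦
    measurableSet_le measurable_const hψm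
  have hD0 : 0 ≤ C * Real.exp (-c * R₀) :=
    (mul_nonneg (Real.exp_pos _).le measureReal_nonneg).trans (htail R₀ le_rfl)
  have hC0 : 0 ≤ C := (mul_nonneg_iff_of_pos_right (Real.exp_pos _)).1 hD0
  have hgc : Continuous fun r ↦ Real.exp (κ * r) * κ := by fun_prop
  have hg0 : ∀ r, 0 ≤ Real.exp (κ * r) * κ := fun r ↦ mul_nonneg (Real.exp_pos _).le hκ
  have hE0 : 0 ≤ Real.exp (κ * R₀) - 1 := sub_nonneg.2 (Real.one_le_exp (mul_nonneg hκ hR₀.le))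
  have he1 : ∀ y, 0 ≤ Real.exp (κ * ψ y) - 1 := fun y ↦
    sub_nonneg.2 (Real.one_le_exp (mul_nonneg hκ (hψ0 y)))
  -- the layer-cake formula for `e^{κψ} − 1 = ∫₀^ψ κ e^{κr} dr` on `μ = ν|_S`
  have hlc : ∫⁻ y, ENNReal.ofReal (Real.exp (κ * ψ y) - 1) ∂μ =
      ∫⁻ r in Ioi 0, μ {y | r ≤ ψ y} * ENNReal.ofReal (Real.exp (κ * r) * κ) := by
    have := lintegral_comp_eq_lintegral_meas_le_mul μ (f := ψ)
      (g := fun r ↦ Real.exp (κ * r) * κ) (ae_of_all _ hψ0) hψm.aemeasurable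
      (fun T _ ↦ hgc.intervalIntegrable _ _) (ae_of_all _ hg0)
    simpa only [intervalIntegral_exp_mul_mul] using this
  -- small levels `r ≤ R₀`: the integrand is at most `ν(S) κ e^{κr}`
  have ha : ∫⁻ r in Ioc 0 R₀, μ {y | r ≤ ψ y} * ENNReal.ofReal (Real.exp (κ * r) * κ) ≤
      ν S * ENNReal.ofReal (Real.exp (κ * R₀) - 1) := by
    calc ∫⁻ r in Ioc 0 R₀, μ {y | r ≤ ψ y} * ENNReal.ofReal (Real.exp (κ * r) * κ)
        ≤ ∫⁻ r in Ioc 0 R₀, ν S * ENNReal.ofReal (Real.exp (κ * r) * κ) := by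
          refine lintegral_mono fun r ↦ mul_le_mul_left ?_ _
          calc μ {y | r ≤ ψ y} ≤ μ univ := measure_mono (subset_univ _)
            _ = ν S := Measure.restrict_apply_univ S
      _ = ν S * ∫⁻ r in Ioc 0 R₀, ENNReal.ofReal (Real.exp (κ * r) * κ) :=
          lintegral_const_mul _ hgc.measurable.ennreal_ofReal
      _ = ν S * ENNReal.ofReal (Real.exp (κ * R₀) - 1) := by
          rw [← ofReal_integral_eq_lintegral_ofReal hgc.integrableOn_Ioc (ae_of_all _ hg0),
            ← intervalIntegral.integral_of_le hR₀.le, intervalIntegral_exp_mul_mul]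
  -- large levels `r > R₀`: the tail hypothesis
  have hneg : -c < 0 := neg_lt_zero.2 hc
  have hb : ∫⁻ r in Ioi R₀, μ {y | r ≤ ψ y} * ENNReal.ofReal (Real.exp (κ * r) * κ) ≤
      ENNReal.ofReal (C * Real.exp (-c * R₀) * (κ / c)) := by
    calc ∫⁻ r in Ioi R₀, μ {y | r ≤ ψ y} * ENNReal.ofReal (Real.exp (κ * r) * κ)
        ≤ ∫⁻ r in Ioi R₀, ENNReal.ofReal (κ * C * Real.exp (-c * r)) := by
          refine setLIntegral_mono' measurableSet_Ioi fun r hr ↦ ?_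
          have hr' : R₀ ≤ r := le_of_lt hr
          have hμr : μ {y | r ≤ ψ y} ≤ ENNReal.ofReal (ν.real {y | r ≤ ψ y}) := by
            rw [ofReal_measureReal (measure_ne_top _ _), hμ, Measure.restrict_apply (hlev r)]
            exact measure_mono inter_subset_left
          calc μ {y | r ≤ ψ y} * ENNReal.ofReal (Real.exp (κ * r) * κ)
              ≤ ENNReal.ofReal (ν.real {y | r ≤ ψ y}) * ENNReal.ofReal (Real.exp (κ * r) * κ) :=
                mul_le_mul_left hμr _
            _ = ENNReal.ofReal (κ * (Real.exp (κ * r) * ν.real {y | r ≤ ψ y})) := by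
                rw [← ENNReal.ofReal_mul measureReal_nonneg]
                congr 1
                ring
            _ ≤ ENNReal.ofReal (κ * C * Real.exp (-c * r)) := by
                refine ENNReal.ofReal_le_ofReal ?_
                rw [mul_assoc κ]
                exact mul_le_mul_of_nonneg_left (htail r hr') hκ
      _ = ENNReal.ofReal (∫ r in Ioi R₀, κ * C * Real.exp (-c * r)) :=
          (ofReal_integral_eq_lintegral_ofReal ((integrableOn_exp_mul_Ioi hneg R₀).const_mul _)
            (ae_of_all _ fun r ↦ mul_nonneg (mul_nonneg hκ hC0) (Real.exp_pos _).le)).symm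
      _ = ENNReal.ofReal (C * Real.exp (-c * R₀) * (κ / c)) := by
          rw [integral_const_mul, integral_exp_mul_Ioi hneg R₀, neg_div_neg_eq]
          congr 1
          have hc' : c ≠ 0 := hc.ne'
          field_simp
  -- both ranges together
  have htot : ∫⁻ y, ENNReal.ofReal (Real.exp (κ * ψ y) - 1) ∂μ ≤
      ENNReal.ofReal (ν.real S * (Real.exp (κ * R₀) - 1) + C * Real.exp (-c * R₀) * (κ / c)) := by
    rw [hlc, ← Ioc_union_Ioi_eq_Ioi hR₀.le, lintegral_union measurableSet_Ioi Ioc_disjoint_Ioi_same,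
      ENNReal.ofReal_add (mul_nonneg measureReal_nonneg hE0) (by positivity),
      ENNReal.ofReal_mul measureReal_nonneg, ofReal_measureReal (measure_ne_top ν S)]
    exact add_le_add ha hb
  -- back to the Bochner integral of `e^{κψ} = (e^{κψ} − 1) + 1`
  have hmeas : Measurable fun y ↦ Real.exp (κ * ψ y) := by fun_prop
  rw [integral_eq_lintegral_of_nonneg_ae (ae_of_all _ fun y ↦ (Real.exp_pos _).le)
    hmeas.aestronglyMeasurable]
  have hdec : ∫⁻ y, ENNReal.ofReal (Real.exp (κ * ψ y)) ∂μ =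
      ∫⁻ y, ENNReal.ofReal (Real.exp (κ * ψ y) - 1) ∂μ + ν S := by
    have hpt : ∀ y, ENNReal.ofReal (Real.exp (κ * ψ y)) =
        ENNReal.ofReal (Real.exp (κ * ψ y) - 1) + 1 := fun y ↦ by
      rw [← ENNReal.ofReal_one, ← ENNReal.ofReal_add (he1 y) zero_le_one, sub_add_cancel]
    simp_rw [hpt]
    rw [lintegral_add_right _ measurable_const, lintegral_one, hμ, Measure.restrict_apply_univ]
  have hB0 : 0 ≤ ν.real S * (Real.exp (κ * R₀) - 1) + C * Real.exp (-c * R₀) * (κ / c) +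
      ν.real S := add_nonneg (add_nonneg (mul_nonneg measureReal_nonneg hE0) (by positivity))
    measureReal_nonneg
  have hfin : ∫⁻ y, ENNReal.ofReal (Real.exp (κ * ψ y) - 1) ∂μ + ν S ≤ ENNReal.ofReal
      (ν.real S * (Real.exp (κ * R₀) - 1) + C * Real.exp (-c * R₀) * (κ / c) + ν.real S) := by
    rw [ENNReal.ofReal_add (add_nonneg (mul_nonneg measureReal_nonneg hE0) (by positivity))
      measureReal_nonneg, ofReal_measureReal (measure_ne_top ν S)]
    exact add_le_add htot le_rfl
  rw [hdec]
  refine (ENNReal.toReal_le_of_le_ofReal hB0 hfin).trans ?_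
  have hS0 : Real.exp (κ * R₀) * ν.real S ≤ C * Real.exp (-c * R₀) := htail R₀ le_rfl
  nlinarith [hS0]

end LayerCake

/-! ### The kernel statements -/

section Kernel

variable {m : ℕ} {H : Type*} [TopologicalSpace H]
  {I : ModelWithCorners ℝ (EuclideanSpace ℝ (Fin m)) H} [I.Boundaryless]
  {M : Type*} [TopologicalSpace M] [ChartedSpace H M] [IsManifold I ∞ M]
  [T2Space M] [CompactSpace M] [SecondCountableTopology M] [MeasurableSpace M] [BorelSpace M]
  [ConnectedSpace M] [T3Space M]
  {h : ℝ → PseudoRiemannianMetric I ∞ (EuclideanSpace ℝ (Fin m)) (TangentSpace I : M → Type _)}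
  {cov : ℝ → CovariantDerivative I (EuclideanSpace ℝ (Fin m)) (TangentSpace I : M → Type _)}
  {a T : ℝ} (hflow : IsRicciFlow h cov (Icc a T)) (hh : IsContMDiffFamilyOn ∞ h univ)
  (hR : ∀ r, (h r).IsRiemannian)

include hflow in
/-- **Gaussian tails at an `H_m`-centre, simplified form** (from Bamler 2020a, Thm. 3.12): if
`∫ d_s(z,·)² dν_{x,t;s} ≤ H_m (t − s)`, then for every `r > 0`

  `ν_{x,t;s} {d_s(z,·) ≥ r} ≤ 2 e^{2H_m} e^{−r²/(9(t − s))}`,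

from `ν{d ≥ r} ≤ 2 exp(−(r − √(2H_m(t−s)))₊²/(8(t−s)))` and `(r − A)₊² ≥ (8/9)r² − 8A²`,
`A² = 2H_m(t − s)` (if `H_m < 0`, i.e. `m = 0`, the variance bound forces the set to be null).
[cite: Bamler2020Entropy, §3.1, Thm. 3.12 and §7.3, (7.20)] -/
theorem heatKernelMeasure_real_setOf_le_edist_le_exp_mul_exp {s t : ℝ} (has : a < s)
    (hst : s < t) (htT : t ≤ T) (x z : M)
    (hz : ∫⁻ w, (h s).edist (hR s) z w ^ 2 ∂(heatKernelMeasure hh hR t x s) ≤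
      ENNReal.ofReal ((((m : ℝ) - 1) * Real.pi ^ 2 / 2 + 4) * (t - s)))
    {r : ℝ} (hr : 0 < r) :
    (heatKernelMeasure hh hR t x s).real {y | ENNReal.ofReal r ≤ (h s).edist (hR s) z y} ≤
      2 * Real.exp (2 * (((m : ℝ) - 1) * Real.pi ^ 2 / 2 + 4)) *
        Real.exp (-r ^ 2 / (9 * (t - s))) := by
  set ν := heatKernelMeasure hh hR t x s with hν
  set Hm : ℝ := ((m : ℝ) - 1) * Real.pi ^ 2 / 2 + 4 with hHm
  have hσ : 0 < t - s := sub_pos.2 hst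
  rcases lt_or_ge Hm 0 with hH | hH
  · -- degenerate case `H_m < 0`: `∫ d² dν = 0`, so `{d ≥ r}` is null by Markov's inequality
    have hcont : Continuous fun y ↦ (h s).edist (hR s) z y :=
      ((h s).continuous_edist (hR s)).comp (.prodMk_right z)
    have h0 : ∫⁻ y, (h s).edist (hR s) z y ^ 2 ∂ν = 0 := by
      refine le_antisymm (hz.trans_eq ?_) zero_le
      exact ENNReal.ofReal_of_nonpos (mul_nonpos_of_nonpos_of_nonneg hH.le hσ.le)
    have hr2 : ENNReal.ofReal r ^ 2 ≠ 0 := pow_ne_zero _ (ENNReal.ofReal_pos.2 hr).ne'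
    have hmarkov := meas_ge_le_lintegral_div ((hcont.measurable.pow_const 2).aemeasurable) hr2
      (ENNReal.pow_ne_top ENNReal.ofReal_ne_top) (μ := ν)
    rw [h0, ENNReal.zero_div] at hmarkov
    have hsub : {y | ENNReal.ofReal r ≤ (h s).edist (hR s) z y} ⊆
        {y | ENNReal.ofReal r ^ 2 ≤ (h s).edist (hR s) z y ^ 2} := fun y hy ↦
      pow_le_pow_left' (show ENNReal.ofReal r ≤ (h s).edist (hR s) z y from hy) 2
    have hnull : ν {y | ENNReal.ofReal r ≤ (h s).edist (hR s) z y} = 0 :=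
      le_antisymm ((measure_mono hsub).trans hmarkov) zero_le
    rw [measureReal_def, hnull, ENNReal.toReal_zero]
    positivity
  · -- main case: Thm. 3.12 and `(r − A)₊² ≥ (8/9) r² − 8A²`
    have h312 := heatKernelMeasure_real_setOf_le_edist_le hflow hh hR has hst htT x z hz r hr.le
    refine h312.trans ?_
    rw [mul_assoc, ← Real.exp_add]
    refine mul_le_mul_of_nonneg_left (Real.exp_le_exp.2 ?_) zero_le_two
    set A : ℝ := Real.sqrt (2 * (Hm * (t - s))) with hA
    have hA2 : A ^ 2 = 2 * (Hm * (t - s)) := Real.sq_sqrt (by positivity)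
    have hB := sq_sub_sq_le_max_sub_sq hr.le A
    rw [hA2] at hB
    have h8 : (0 : ℝ) < 8 * (t - s) := by positivity
    have h9 : (0 : ℝ) < 9 * (t - s) := by positivity
    rw [neg_div, neg_div, neg_le, le_div_iff₀ h8]
    have h1 : -(2 * Hm + -(r ^ 2 / (9 * (t - s)))) * (8 * (t - s)) =
        8 / 9 * r ^ 2 - 16 * (Hm * (t - s)) := by
      field_simp
      ring
    rw [h1]
    linarith

include hflow in
/-- **Exponentially weighted Gaussian tails at an `H_m`-centre**: under the same hypotheses, for
`κ ∈ ℝ` and `r > 0`,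

  `e^{κr} ν_{x,t;s} {d_s(z,·) ≥ r} ≤ 2 e^{25κ²(t−s) + 2H_m} e^{−r²/(10(t − s))}`

(`κ r ≤ r²/(100σ) + 25κ²σ` and `1/100 − 1/9 ≤ −1/10`; Bamler: "C θ^{-1/2} r − (r − √(2H_n))²/8
≤ Cθ^{-1} + r²/100 − r²/9 + C ≤ Cθ^{-1} − r²/10 + C"). [cite: Bamler2020Entropy, §7.3, (7.20)] -/
theorem exp_mul_mul_heatKernelMeasure_real_setOf_le_edist_le {s t : ℝ} (has : a < s)
    (hst : s < t) (htT : t ≤ T) (x z : M)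
    (hz : ∫⁻ w, (h s).edist (hR s) z w ^ 2 ∂(heatKernelMeasure hh hR t x s) ≤
      ENNReal.ofReal ((((m : ℝ) - 1) * Real.pi ^ 2 / 2 + 4) * (t - s)))
    (κ : ℝ) {r : ℝ} (hr : 0 < r) :
    Real.exp (κ * r) *
        (heatKernelMeasure hh hR t x s).real {y | ENNReal.ofReal r ≤ (h s).edist (hR s) z y} ≤
      2 * Real.exp (25 * κ ^ 2 * (t - s) + 2 * (((m : ℝ) - 1) * Real.pi ^ 2 / 2 + 4)) *
        Real.exp (-r ^ 2 / (10 * (t - s))) := by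
  set Hm : ℝ := ((m : ℝ) - 1) * Real.pi ^ 2 / 2 + 4 with hHm
  have hσ : 0 < t - s := sub_pos.2 hst
  have htail := heatKernelMeasure_real_setOf_le_edist_le_exp_mul_exp hflow hh hR has hst htT x z
    hz hr
  have hκr : Real.exp (κ * r) ≤ Real.exp (r ^ 2 / (100 * (t - s)) + 25 * κ ^ 2 * (t - s)) :=
    Real.exp_le_exp.2 (mul_le_sq_div_add_sq_mul hσ κ r)
  calc Real.exp (κ * r) *
        (heatKernelMeasure hh hR t x s).real {y | ENNReal.ofReal r ≤ (h s).edist (hR s) z y}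
      ≤ Real.exp (r ^ 2 / (100 * (t - s)) + 25 * κ ^ 2 * (t - s)) *
          (2 * Real.exp (2 * Hm) * Real.exp (-r ^ 2 / (9 * (t - s)))) :=
        mul_le_mul hκr htail measureReal_nonneg (Real.exp_pos _).le
    _ = 2 * Real.exp (r ^ 2 / (100 * (t - s)) + 25 * κ ^ 2 * (t - s) + 2 * Hm +
          -r ^ 2 / (9 * (t - s))) := by
        rw [Real.exp_add _ (-r ^ 2 / (9 * (t - s))), Real.exp_add _ (2 * Hm)]
        ring
    _ ≤ 2 * Real.exp (25 * κ ^ 2 * (t - s) + 2 * Hm + -r ^ 2 / (10 * (t - s))) := by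
        refine mul_le_mul_of_nonneg_left (Real.exp_le_exp.2 ?_) zero_le_two
        have h1 : r ^ 2 / (100 * (t - s)) + -r ^ 2 / (9 * (t - s)) - -r ^ 2 / (10 * (t - s)) =
            -(r ^ 2 / (900 * (t - s))) := by
          field_simp
          ring
        have h2 : 0 ≤ r ^ 2 / (900 * (t - s)) := by positivity
        linarith
    _ = 2 * Real.exp (25 * κ ^ 2 * (t - s) + 2 * Hm) * Real.exp (-r ^ 2 / (10 * (t - s))) := by
        rw [Real.exp_add _ (-r ^ 2 / (10 * (t - s)))]
        ring

include hflow in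
/-- **Tail exponential moment of the distance from an `H_m`-centre** (the layer-cake term of
Bamler 2020a, (7.20)). Let `(h, cov)` be a Ricci flow on `[a, T]` of a smooth family of
Riemannian metrics on a closed connected manifold `M` modelled on `ℝᵐ`, `a < s < t ≤ T`,
`x ∈ M`, `ν = ν_{x,t;s}`, and `z` an `H_m`-centre of `(x, t)` at time `s`:
`∫ d_s(z,y)² dν(y) ≤ H_m (t − s)`, `H_m = (m − 1)π²/2 + 4`. Then for `κ ≥ 0`, `R₀ > 0`,
`σ = t − s`,

  `∫_{d_s(z,·) ≥ R₀} e^{κ d_s(z,y)} dν(y) ≤ 2 e^{25κ²σ + 2H_m} (1 + 10κσ/R₀) e^{−R₀²/(10σ)}`.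

Proof: `e^{κr} ν{d ≥ r} ≤ 2e^{25κ²σ + 2H_m} e^{−r²/(10σ)} ≤ 2e^{25κ²σ + 2H_m} e^{−rR₀/(10σ)}`
for `r ≥ R₀` (`exp_mul_mul_heatKernelMeasure_real_setOf_le_edist_le`) and the layer-cake lemma
`setIntegral_exp_mul_le_of_forall_exp_mul_measureReal_le` with `c = R₀/(10σ)`.
[cite: Bamler2020Entropy, §7.3, proof of Lemma 7.10, (7.20)] -/
theorem setIntegral_exp_mul_edist_heatKernelMeasure_le {s t : ℝ} (has : a < s) (hst : s < t)
    (htT : t ≤ T) (x z : M)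
    (hz : ∫⁻ w, (h s).edist (hR s) z w ^ 2 ∂(heatKernelMeasure hh hR t x s) ≤
      ENNReal.ofReal ((((m : ℝ) - 1) * Real.pi ^ 2 / 2 + 4) * (t - s)))
    {κ R₀ : ℝ} (hκ : 0 ≤ κ) (hR₀ : 0 < R₀) :
    ∫ y in {y | ENNReal.ofReal R₀ ≤ (h s).edist (hR s) z y},
        Real.exp (κ * ((h s).edist (hR s) z y).toReal) ∂(heatKernelMeasure hh hR t x s) ≤
      2 * Real.exp (25 * κ ^ 2 * (t - s) + 2 * (((m : ℝ) - 1) * Real.pi ^ 2 / 2 + 4)) *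
        (1 + 10 * κ * (t - s) / R₀) * Real.exp (-R₀ ^ 2 / (10 * (t - s))) := by
  set ν := heatKernelMeasure hh hR t x s with hν
  have hσ : 0 < t - s := sub_pos.2 hst
  have hσ10 : 0 < 10 * (t - s) := by positivity
  have hcont : Continuous fun y ↦ (h s).edist (hR s) z y :=
    ((h s).continuous_edist (hR s)).comp (.prodMk_right z)
  have hfin : ∀ y, (h s).edist (hR s) z y ≠ ⊤ := fun y ↦
    PseudoRiemannianMetric.edist_ne_top (hR s) z y
  set ψ : M → ℝ := fun y ↦ ((h s).edist (hR s) z y).toReal with hψ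
  have hψc : Continuous ψ := continuous_iff_continuousAt.2 fun y ↦
    (ENNReal.tendsto_toReal (hfin y)).comp (hcont.tendsto y)
  have hψ0 : ∀ y, 0 ≤ ψ y := fun _ ↦ ENNReal.toReal_nonneg
  have hset : ∀ r : ℝ, {y | ENNReal.ofReal r ≤ (h s).edist (hR s) z y} = {y | r ≤ ψ y} :=
    fun r ↦ Set.ext fun y ↦ ENNReal.ofReal_le_iff_le_toReal (hfin y)
  -- exponential tails for `r ≥ R₀`
  have htail : ∀ r, R₀ ≤ r → Real.exp (κ * r) * ν.real {y | r ≤ ψ y} ≤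
      2 * Real.exp (25 * κ ^ 2 * (t - s) + 2 * (((m : ℝ) - 1) * Real.pi ^ 2 / 2 + 4)) *
        Real.exp (-(R₀ / (10 * (t - s))) * r) := by
    intro r hr
    have hr0 : 0 < r := hR₀.trans_le hr
    rw [← hset r]
    refine (exp_mul_mul_heatKernelMeasure_real_setOf_le_edist_le hflow hh hR has hst htT x z hz
      κ hr0).trans (mul_le_mul_of_nonneg_left (Real.exp_le_exp.2 ?_) (by positivity))
    rw [neg_div, neg_mul, div_mul_eq_mul_div, neg_le_neg_iff]
    refine div_le_div_of_nonneg_right ?_ hσ10.le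
    rw [sq]
    exact mul_le_mul_of_nonneg_right hr hr0.le
  have key := setIntegral_exp_mul_le_of_forall_exp_mul_measureReal_le ν hψc.measurable hψ0 hκ
    hR₀ (by positivity : 0 < R₀ / (10 * (t - s))) htail
  rw [hset R₀]
  refine key.trans (le_of_eq ?_)
  have h1 : -(R₀ / (10 * (t - s))) * R₀ = -R₀ ^ 2 / (10 * (t - s)) := by ring
  have h2 : κ / (R₀ / (10 * (t - s))) = 10 * κ * (t - s) / R₀ := by
    rw [div_div_eq_mul_div]
    ring
  rw [h1, h2]
  ring

/-- **The splitting (7.20)** (Bamler 2020a, §7.3, proof of Lemma 7.10): mass of the level set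
`V = {K(x,t;y,s) ≤ 2K(·,t₁;y,s)}` near an `H_m`-centre controls the kernel. Let `(h, cov)` be a
Ricci flow on `[a, T]` of a smooth family of Riemannian metrics on a closed connected manifold `M`
modelled on `ℝᵐ`, `a < s < t₁ < t ≤ T`, `x, y ∈ M`, `ν₁ = ν_{x,t;t₁}`, `z'` an `H_m`-centre of
`(x, t)` at time `t₁` (`∫ d_{t₁}(z',·)² dν₁ ≤ H_m (t − t₁)`), and suppose the pointwise majorant
`K(w,t₁;y,s) ≤ A₀ e^{κ d_{t₁}(z',w)}` (`A₀, κ ≥ 0`). Then for every `R₀ > 0`, with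
`B = {d_{t₁}(z',·) < R₀}` and `σ = t − t₁`,

  `K(x,t;y,s) ≤ 2A₀ (e^{κR₀} ν₁(V ∩ B) + 2 e^{25κ²σ + 2H_m} (1 + 10κσ/R₀) e^{−R₀²/(10σ)})`.

Proof: `K(x,t;y,s) = ∫ K(·,t₁;y,s) dν₁` (reproduction); on `Vᶜ` the integrand is `< K(x,t;y,s)/2`,
on `V` it is `≤ A₀ e^{κd}`, which is `≤ A₀ e^{κR₀}` on `B` and whose integral over `Bᶜ = {d ≥ R₀}`
is the tail exponential moment `setIntegral_exp_mul_edist_heatKernelMeasure_le`.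
[cite: Bamler2020Entropy, §7.3, proof of Lemma 7.10, (7.20)] -/
theorem heatKernelFn_le_of_forall_le_exp_mul_edist {s t₁ t : ℝ} (has : a < s) (hst₁ : s < t₁)
    (ht₁t : t₁ < t) (htT : t ≤ T) (x y z' : M)
    (hz' : ∫⁻ w, (h t₁).edist (hR t₁) z' w ^ 2 ∂(heatKernelMeasure hh hR t x t₁) ≤
      ENNReal.ofReal ((((m : ℝ) - 1) * Real.pi ^ 2 / 2 + 4) * (t - t₁)))
    {A₀ κ R₀ : ℝ} (hA₀ : 0 ≤ A₀) (hκ : 0 ≤ κ) (hR₀ : 0 < R₀)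
    (hpt : ∀ w, hflow.heatKernelFn hh hR t₁ w (y, s) ≤
      A₀ * Real.exp (κ * ((h t₁).edist (hR t₁) z' w).toReal)) :
    hflow.heatKernelFn hh hR t x (y, s) ≤
      2 * A₀ * (Real.exp (κ * R₀) *
          (heatKernelMeasure hh hR t x t₁).real
            ({w | hflow.heatKernelFn hh hR t x (y, s) ≤ 2 * hflow.heatKernelFn hh hR t₁ w (y, s)} ∩
              {w | (h t₁).edist (hR t₁) z' w < ENNReal.ofReal R₀}) +
        2 * Real.exp (25 * κ ^ 2 * (t - t₁) + 2 * (((m : ℝ) - 1) * Real.pi ^ 2 / 2 + 4)) *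
          (1 + 10 * κ * (t - t₁) / R₀) * Real.exp (-R₀ ^ 2 / (10 * (t - t₁)))) := by
  have hat₁ : a < t₁ := has.trans hst₁
  have ht₁T : t₁ ≤ T := ht₁t.le.trans htT
  -- the tail exponential moment at times `t₁ < t`
  have hT := setIntegral_exp_mul_edist_heatKernelMeasure_le hflow hh hR hat₁ ht₁t htT x z' hz'
    hκ hR₀
  set Tb : ℝ := 2 * Real.exp (25 * κ ^ 2 * (t - t₁) + 2 * (((m : ℝ) - 1) * Real.pi ^ 2 / 2 + 4)) *
    (1 + 10 * κ * (t - t₁) / R₀) * Real.exp (-R₀ ^ 2 / (10 * (t - t₁))) with hTb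
  set ν₁ := heatKernelMeasure hh hR t x t₁ with hν₁
  set K₀ : ℝ := hflow.heatKernelFn hh hR t x (y, s) with hK₀
  set V : Set M := {w | K₀ ≤ 2 * hflow.heatKernelFn hh hR t₁ w (y, s)} with hV
  set B : Set M := {w | (h t₁).edist (hR t₁) z' w < ENNReal.ofReal R₀} with hB
  -- the integrand `u = K(·,t₁;y,s)` and the majorant `e = exp(κ d_{t₁}(z',·))`
  set u : M → ℝ := fun w ↦ hflow.heatKernelFn hh hR t₁ w (y, s) with hu
  have huc : Continuous u :=
    (hflow.continuousOn_heatKernelFn hh hR ⟨hat₁, ht₁T⟩).comp_continuous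
      (continuous_id.prodMk continuous_const) fun _ ↦ ⟨mem_univ _, mem_univ _, has, hst₁⟩
  have hK₀0 : 0 ≤ K₀ :=
    (hflow.heatKernelFn_pos hh hR ⟨hat₁.trans ht₁t, htT⟩ x ⟨mem_univ _, has, hst₁.trans ht₁t⟩).le
  have hcont : Continuous fun w ↦ (h t₁).edist (hR t₁) z' w :=
    ((h t₁).continuous_edist (hR t₁)).comp (.prodMk_right z')
  have hfin : ∀ w, (h t₁).edist (hR t₁) z' w ≠ ⊤ := fun w ↦
    PseudoRiemannianMetric.edist_ne_top (hR t₁) z' w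
  set ψ : M → ℝ := fun w ↦ ((h t₁).edist (hR t₁) z' w).toReal with hψ
  have hψc : Continuous ψ := continuous_iff_continuousAt.2 fun w ↦
    (ENNReal.tendsto_toReal (hfin w)).comp (hcont.tendsto w)
  set e : M → ℝ := fun w ↦ Real.exp (κ * ψ w) with he
  have hec : Continuous e := by
    simp only [he]
    fun_prop
  have hint : ∀ {f : M → ℝ}, Continuous f → Integrable f ν₁ := fun hf ↦
    hf.integrable_of_hasCompactSupport (HasCompactSupport.of_compactSpace _)
  have hVm : MeasurableSet V := measurableSet_le measurable_const (huc.measurable.const_mul 2)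
  have hBm : MeasurableSet B := measurableSet_lt hcont.measurable measurable_const
  -- reproduction formula
  have hrep : K₀ = ∫ w, u w ∂ν₁ :=
    hflow.heatKernelFn_reproduction hh hR hat₁ ht₁t htT x ⟨has, hst₁⟩ y
  -- off `V`: `u < K₀/2`
  have h1 : ∫ w in Vᶜ, u w ∂ν₁ ≤ K₀ / 2 := by
    calc ∫ w in Vᶜ, u w ∂ν₁ ≤ ∫ w in Vᶜ, K₀ / 2 ∂ν₁ :=
          setIntegral_mono_on (hint huc).integrableOn (integrable_const _).integrableOn hVm.compl
            fun w hw ↦ by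
              have hw' : ¬ K₀ ≤ 2 * u w := hw
              linarith [not_le.1 hw']
      _ = ν₁.real Vᶜ * (K₀ / 2) := by rw [setIntegral_const, smul_eq_mul]
      _ ≤ 1 * (K₀ / 2) := mul_le_mul_of_nonneg_right measureReal_le_one (by positivity)
      _ = K₀ / 2 := one_mul _
  -- on `V ∩ B`: `e ≤ e^{κR₀}`
  have h2 : ∫ w in V ∩ B, e w ∂ν₁ ≤ Real.exp (κ * R₀) * ν₁.real (V ∩ B) := by
    calc ∫ w in V ∩ B, e w ∂ν₁ ≤ ∫ w in V ∩ B, Real.exp (κ * R₀) ∂ν₁ :=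
          setIntegral_mono_on (hint hec).integrableOn (integrable_const _).integrableOn
            (hVm.inter hBm) fun w hw ↦ by
              have hlt : ψ w < R₀ := (ENNReal.lt_ofReal_iff_toReal_lt (hfin w)).1 hw.2
              exact Real.exp_le_exp.2 (mul_le_mul_of_nonneg_left hlt.le hκ)
      _ = Real.exp (κ * R₀) * ν₁.real (V ∩ B) := by rw [setIntegral_const, smul_eq_mul, mul_comm]
  -- on `V \ B ⊆ Bᶜ = {d ≥ R₀}`: the tail exponential moment
  have h3 : ∫ w in V \ B, e w ∂ν₁ ≤ Tb := by
    have hBc : Bᶜ = {w | ENNReal.ofReal R₀ ≤ (h t₁).edist (hR t₁) z' w} := by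
      ext w
      simp [hB, not_lt]
    calc ∫ w in V \ B, e w ∂ν₁ ≤ ∫ w in Bᶜ, e w ∂ν₁ :=
          setIntegral_mono_set (hint hec).integrableOn (ae_of_all _ fun w ↦ (Real.exp_pos _).le)
            (LE.le.eventuallyLE (Set.sdiff_subset_compl V B))
      _ ≤ Tb := by
          rw [hBc]
          exact hT
  -- on `V`: the majorant, split over `B`
  have h4 : ∫ w in V, u w ∂ν₁ ≤ A₀ * (Real.exp (κ * R₀) * ν₁.real (V ∩ B) + Tb) := by
    calc ∫ w in V, u w ∂ν₁ ≤ ∫ w in V, A₀ * e w ∂ν₁ :=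
          setIntegral_mono_on (hint huc).integrableOn ((hint hec).const_mul A₀).integrableOn hVm
            fun w _ ↦ hpt w
      _ = A₀ * ∫ w in V, e w ∂ν₁ := integral_const_mul _ _
      _ = A₀ * (∫ w in V ∩ B, e w ∂ν₁ + ∫ w in V \ B, e w ∂ν₁) := by
          rw [integral_inter_add_sdiff hBm (hint hec).integrableOn]
      _ ≤ A₀ * (Real.exp (κ * R₀) * ν₁.real (V ∩ B) + Tb) :=
          mul_le_mul_of_nonneg_left (add_le_add h2 h3) hA₀
  -- assemble
  have hsplit : K₀ = ∫ w in V, u w ∂ν₁ + ∫ w in Vᶜ, u w ∂ν₁ := by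
    rw [integral_add_compl hVm (hint huc), ← hrep]
  show K₀ ≤ 2 * A₀ * (Real.exp (κ * R₀) * ν₁.real (V ∩ B) + Tb)
  nlinarith [hsplit, h1, h4]

end Kernel

end Literature.Geometry.Riemannian
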